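import Mathlib.Analysis.Convex.Deriv
import Literature.MathematicalPhysics.QuantumLattice.HubbardTTPrimeTPPFillingTransport
import HarnessLib

/-!
# One-sided derivatives of the variational ground-state energy density of a pencil `Ψ₀ + sΨ₁` over an
# ARBITRARY state class, and the Griffiths bracket for the class minimisers (families of models at `T = 0`)

Topic `Literature/MathematicalPhysics/QuantumLattice` (namespace = path; family `hubbard`, model-free part
general `d`). The class-generic twin of `MeanEnergyMinimiserConjugateRange.lean` (hubbard-cq-p5: the
TRANSLATION-INVARIANT class, `tiGroundEnergyDensity`) and of `HubbardDoubleOccupancyTL.lean` (hubbard-box-p1: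
the density-`n` class of the `t–t'` Hubbard model along the `U`-direction, `doccPlusTT'/doccMinusTT'`). For a
pencil of interactions `Ψ₀ + sΨ₁` (`FermionInteraction.pencil`) and ANY non-empty class `S` of infinite-volume
states (translation-invariant states of a fixed density, of fixed conserved charges, symmetry-restricted or
periodic classes, …) the variational ground-state energy density

  `f(s) := infMeanEnergyOn S (Ψ₀ + sΨ₁) R = inf {e_{Ψ₀+sΨ₁}(ω) : ω ∈ S}`

is CONCAVE on `ℝ` (an infimum of the affine functions `s ↦ e_{Ψ₀}(ω) + s·e_{Ψ₁}(ω)`,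
`concaveOn_infMeanEnergyOn_pencil` of `HubbardTTPrimeTPPFillingTransport.lean`; Israel 1979 Thm. I.3.4 / Ruelle 1969 §3.4 / Koma–Tasaki 1994 §1), hence
(Mathlib's one-sided differentiability of convex functions at interior points):

* `hasDerivWithinAt_Ioi_Iio_infMeanEnergyOn_pencil`: the one-sided derivatives `∂⁺f(σ)`, `∂⁻f(σ)`
  (`derivWithin f (Ioi σ) σ`, `derivWithin f (Iio σ) σ`) exist at every `σ`, `∂⁺f ≤ ∂⁻f`, and the slopes
  converge to them (`tendsto_slope_nhdsGT/LT_infMeanEnergyOn_pencil`); secant sandwiches and their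
  CERTIFIED forms (`rightDeriv_infMeanEnergyOn_pencil_ge_of_bounds`: a cap on `f(σ)` and a floor on `f(τ)`,
  `τ > σ`, give `(lo − hi)/(τ − σ) ≤ ∂⁺f(σ)`; `leftDeriv_…_le_of_bounds`);
* GRIFFITHS' BRACKET (`meanEnergy_mem_Icc_derivs_of_isMinOn`): every CLASS MINIMISER `ω ∈ S` of
  `Ψ₀ + σΨ₁` has conjugate density `e_{Ψ₁}(ω) ∈ [∂⁺f(σ), ∂⁻f(σ)]` (its conjugate density is a supergradient:
  `f(τ) ≤ e_{Ψ₀+τΨ₁}(ω) = f(σ) + (τ − σ)·e_{Ψ₁}(ω)`); HELLMANN–FEYNMAN at a differentiability point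
  (`meanEnergy_eq_of_isMinOn_of_hasDerivAt`): all class minimisers agree on the conjugate density.

USE (Hubbard material-oracle stage S2, «families of models»): with `S` the translation-invariant states of
density `ρ` and the pencil a coupling direction of a downfolded linear family (`linearFamily_add_single`), the
conjugate density of every ground state of the family (double occupancy along `U`, diagonal-hopping energy along
`t'`, Cu occupation along `ε_d` in the three-band model, …) is bracketed by the one-sided derivatives of the
certified energy table — the `t–t'–U` double occupancy (`HubbardDoubleOccupancyTL`, via
`tiGroundEnergyDensityAt_hubbardTTPrime_eq_energyDensityTT'`) is the first instance.

HONEST SCOPE: existence/attainment of minimisers and the attainment of the endpoints `∂±f(σ)` (weak-* limits,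
`MeanEnergyMinimiserConjugateRange` §ATTAINED for the translation-invariant class) are NOT re-proved here for a
general class; nothing model-specific. Everything is PROVED; no definition, no named fact, zero compute.

## References
* R. B. Israel, *Convexity in the Theory of Lattice Gases* (1979), Thm. I.3.4 and §II.1 eq. (1)–(2).
  [cite: Israel1979, §II.1 eq. (1)–(2)]
* R. B. Griffiths, Phys. Rev. 152 (1966) 240, §II. [cite: Griffiths1966, §II]
* T. Koma, H. Tasaki, J. Stat. Phys. 76 (1994) 745, §1. [cite: KomaTasaki1994, §1]
-/

noncomputable section

namespace Literature.MathematicalPhysics.QuantumLattice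

open _root_.Filter Set
open scoped _root_.Topology

variable {d : ℕ}

namespace FermionInteraction

variable (S : Set (InfVolFermionState d)) (Ψ₀ Ψ₁ : FermionInteraction d) (R : ℝ)

/-! ### Concavity along a pencil over any class: `concaveOn_infMeanEnergyOn_pencil` (hubbard-box-p1,
`HubbardTTPrimeTPPFillingTransport.lean`, any class, no non-emptiness needed) is REUSED, not restated. -/

/-! ### One-sided derivatives exist; ordering; slopes converge -/

/-- **One-sided derivatives of `s ↦ inf_S e_{Ψ₀+sΨ₁}` exist at every coupling** (any class; the empty class gives the constant `0`).
[cite: Israel1979, §II.1 eq. (1)–(2)] -/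
theorem hasDerivWithinAt_Ioi_Iio_infMeanEnergyOn_pencil (σ : ℝ) :
    HasDerivWithinAt (fun s => infMeanEnergyOn S (pencil Ψ₀ Ψ₁ s) R)
        (derivWithin (fun s => infMeanEnergyOn S (pencil Ψ₀ Ψ₁ s) R) (Ioi σ) σ) (Ioi σ) σ ∧
      HasDerivWithinAt (fun s => infMeanEnergyOn S (pencil Ψ₀ Ψ₁ s) R)
        (derivWithin (fun s => infMeanEnergyOn S (pencil Ψ₀ Ψ₁ s) R) (Iio σ) σ) (Iio σ) σ := by
  have hc := (concaveOn_infMeanEnergyOn_pencil S Ψ₀ Ψ₁ R).neg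
  have hint : σ ∈ interior (Set.univ : Set ℝ) := by
    rw [interior_univ]; exact Set.mem_univ σ
  have hR := (hc.differentiableWithinAt_Ioi_of_mem_interior hint).neg
  have hL := (hc.differentiableWithinAt_Iio_of_mem_interior hint).neg
  simp only [neg_neg] at hR hL
  exact ⟨hR.hasDerivWithinAt, hL.hasDerivWithinAt⟩

/-- **`∂⁺ ≤ ∂⁻`** along every pencil over any class (concavity). [cite: Israel1979, §II.1 eq. (1)–(2)] -/
theorem rightDeriv_le_leftDeriv_infMeanEnergyOn_pencil (σ : ℝ) :
    derivWithin (fun s => infMeanEnergyOn S (pencil Ψ₀ Ψ₁ s) R) (Ioi σ) σ ≤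
      derivWithin (fun s => infMeanEnergyOn S (pencil Ψ₀ Ψ₁ s) R) (Iio σ) σ := by
  have hc := (concaveOn_infMeanEnergyOn_pencil S Ψ₀ Ψ₁ R).neg
  have hint : σ ∈ interior (Set.univ : Set ℝ) := by
    rw [interior_univ]; exact Set.mem_univ σ
  have key := hc.leftDeriv_le_rightDeriv_of_mem_interior hint
  have e1 : (-fun s : ℝ => infMeanEnergyOn S (pencil Ψ₀ Ψ₁ s) R) =
      fun s : ℝ => -infMeanEnergyOn S (pencil Ψ₀ Ψ₁ s) R := rfl
  rw [e1, derivWithin.fun_neg, derivWithin.fun_neg] at key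
  linarith

/-- **Right slopes converge to `∂⁺`.** [cite: Israel1979, §II.1 eq. (1)–(2)] -/
theorem tendsto_slope_nhdsGT_infMeanEnergyOn_pencil (σ : ℝ) :
    Tendsto (slope (fun s => infMeanEnergyOn S (pencil Ψ₀ Ψ₁ s) R) σ) (𝓝[>] σ)
      (𝓝 (derivWithin (fun s => infMeanEnergyOn S (pencil Ψ₀ Ψ₁ s) R) (Ioi σ) σ)) :=
  (hasDerivWithinAt_iff_tendsto_slope' self_notMem_Ioi).1
    (hasDerivWithinAt_Ioi_Iio_infMeanEnergyOn_pencil S Ψ₀ Ψ₁ R σ).1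

/-- **Left slopes converge to `∂⁻`.** [cite: Israel1979, §II.1 eq. (1)–(2)] -/
theorem tendsto_slope_nhdsLT_infMeanEnergyOn_pencil (σ : ℝ) :
    Tendsto (slope (fun s => infMeanEnergyOn S (pencil Ψ₀ Ψ₁ s) R) σ) (𝓝[<] σ)
      (𝓝 (derivWithin (fun s => infMeanEnergyOn S (pencil Ψ₀ Ψ₁ s) R) (Iio σ) σ)) :=
  (hasDerivWithinAt_iff_tendsto_slope' self_notMem_Iio).1
    (hasDerivWithinAt_Ioi_Iio_infMeanEnergyOn_pencil S Ψ₀ Ψ₁ R σ).2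

/-! ### Secant sandwiches and their certified forms -/

/-- **Forward secant ≤ `∂⁺`**: `slope f σ τ ≤ ∂⁺f(σ)` for `σ < τ`. [cite: KomaTasaki1994, §1] -/
theorem slope_le_rightDeriv_infMeanEnergyOn_pencil {σ τ : ℝ} (hστ : σ < τ) :
    slope (fun s => infMeanEnergyOn S (pencil Ψ₀ Ψ₁ s) R) σ τ ≤
      derivWithin (fun s => infMeanEnergyOn S (pencil Ψ₀ Ψ₁ s) R) (Ioi σ) σ :=
  (concaveOn_infMeanEnergyOn_pencil S Ψ₀ Ψ₁ R).slope_le_of_hasDerivWithinAt_Ioi (Set.mem_univ σ)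
    (Set.mem_univ τ) hστ (hasDerivWithinAt_Ioi_Iio_infMeanEnergyOn_pencil S Ψ₀ Ψ₁ R σ).1

/-- **`∂⁻` ≤ backward secant**: `∂⁻f(σ) ≤ slope f ρ σ` for `ρ < σ`. [cite: KomaTasaki1994, §1] -/
theorem leftDeriv_le_slope_infMeanEnergyOn_pencil {ρ σ : ℝ} (hρσ : ρ < σ) :
    derivWithin (fun s => infMeanEnergyOn S (pencil Ψ₀ Ψ₁ s) R) (Iio σ) σ ≤
      slope (fun s => infMeanEnergyOn S (pencil Ψ₀ Ψ₁ s) R) ρ σ :=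
  (concaveOn_infMeanEnergyOn_pencil S Ψ₀ Ψ₁ R).le_slope_of_hasDerivWithinAt_Iio (Set.mem_univ ρ)
    (Set.mem_univ σ) hρσ (hasDerivWithinAt_Ioi_Iio_infMeanEnergyOn_pencil S Ψ₀ Ψ₁ R σ).2

/-- **Certified `∂⁺` FLOOR**: a CAP `f(σ) ≤ hi` and a FLOOR `lo ≤ f(τ)` at `τ > σ` give
`(lo − hi)/(τ − σ) ≤ ∂⁺f(σ)` (e.g. a certified energy window at the query coupling and a certified energy floor
at a larger coupling of the same family). [cite: Griffiths1966, §II] -/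
theorem rightDeriv_infMeanEnergyOn_pencil_ge_of_bounds {σ τ hi lo : ℝ} (hστ : σ < τ)
    (hhi : infMeanEnergyOn S (pencil Ψ₀ Ψ₁ σ) R ≤ hi) (hlo : lo ≤ infMeanEnergyOn S (pencil Ψ₀ Ψ₁ τ) R) :
    (lo - hi) / (τ - σ) ≤ derivWithin (fun s => infMeanEnergyOn S (pencil Ψ₀ Ψ₁ s) R) (Ioi σ) σ := by
  refine le_trans ?_ (slope_le_rightDeriv_infMeanEnergyOn_pencil S Ψ₀ Ψ₁ R hστ)
  rw [slope_def_field]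
  exact div_le_div_of_nonneg_right (by linarith) (by linarith)

/-- **Certified `∂⁻` CEILING**: a CAP `f(σ) ≤ hi` and a FLOOR `lo ≤ f(ρ)` at `ρ < σ` give
`∂⁻f(σ) ≤ (hi − lo)/(σ − ρ)`. [cite: Griffiths1966, §II] -/
theorem leftDeriv_infMeanEnergyOn_pencil_le_of_bounds {ρ σ hi lo : ℝ} (hρσ : ρ < σ)
    (hhi : infMeanEnergyOn S (pencil Ψ₀ Ψ₁ σ) R ≤ hi) (hlo : lo ≤ infMeanEnergyOn S (pencil Ψ₀ Ψ₁ ρ) R) :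
    derivWithin (fun s => infMeanEnergyOn S (pencil Ψ₀ Ψ₁ s) R) (Iio σ) σ ≤ (hi - lo) / (σ - ρ) := by
  refine (leftDeriv_le_slope_infMeanEnergyOn_pencil S Ψ₀ Ψ₁ R hρσ).trans ?_
  rw [slope_def_field]
  exact div_le_div_of_nonneg_right (by linarith) (by linarith)

/-! ### Griffiths' bracket for class minimisers -/

variable {S Ψ₀ Ψ₁ R}

/-- **Tangent inequality of a class minimiser**: if `ω ∈ S` minimises `e_{Ψ₀+σΨ₁}` on `S` then
`f(τ) ≤ f(σ) + (τ − σ)·e_{Ψ₁}(ω)` for every `τ` (trial state `ω` at `τ`). [cite: Griffiths1966, §II] -/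
theorem infMeanEnergyOn_pencil_le_add_mul_of_isMinOn {ω : InfVolFermionState d} {σ : ℝ} (hω : ω ∈ S)
    (hmin : IsMinOn (fun ω' : InfVolFermionState d => ω'.meanEnergy (pencil Ψ₀ Ψ₁ σ) R) S ω) (τ : ℝ) :
    infMeanEnergyOn S (pencil Ψ₀ Ψ₁ τ) R ≤
      infMeanEnergyOn S (pencil Ψ₀ Ψ₁ σ) R + (τ - σ) * ω.meanEnergy Ψ₁ R := by
  have h1 := infMeanEnergyOn_le_meanEnergy (pencil Ψ₀ Ψ₁ τ) R hω
  have h2 := meanEnergy_eq_infMeanEnergyOn_of_isMinOn (pencil Ψ₀ Ψ₁ σ) R hω hmin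
  rw [ω.meanEnergy_pencil_eq_add_sub_mul Ψ₀ Ψ₁ σ τ R, h2] at h1
  exact h1

/-- Right slopes lie below the conjugate density of a class minimiser. [cite: Griffiths1966, §II] -/
theorem slope_le_meanEnergy_of_isMinOn {ω : InfVolFermionState d} {σ : ℝ} (hω : ω ∈ S)
    (hmin : IsMinOn (fun ω' : InfVolFermionState d => ω'.meanEnergy (pencil Ψ₀ Ψ₁ σ) R) S ω)
    {τ : ℝ} (hτ : σ < τ) :
    slope (fun s => infMeanEnergyOn S (pencil Ψ₀ Ψ₁ s) R) σ τ ≤ ω.meanEnergy Ψ₁ R := by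
  have key := infMeanEnergyOn_pencil_le_add_mul_of_isMinOn hω hmin τ
  rw [slope_def_field, div_le_iff₀ (sub_pos.2 hτ)]
  linarith

/-- Left slopes lie above the conjugate density of a class minimiser. [cite: Griffiths1966, §II] -/
theorem meanEnergy_le_slope_of_isMinOn {ω : InfVolFermionState d} {σ : ℝ} (hω : ω ∈ S)
    (hmin : IsMinOn (fun ω' : InfVolFermionState d => ω'.meanEnergy (pencil Ψ₀ Ψ₁ σ) R) S ω)
    {τ : ℝ} (hτ : τ < σ) :
    ω.meanEnergy Ψ₁ R ≤ slope (fun s => infMeanEnergyOn S (pencil Ψ₀ Ψ₁ s) R) σ τ := by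
  have key := infMeanEnergyOn_pencil_le_add_mul_of_isMinOn hω hmin τ
  rw [slope_comm, slope_def_field, le_div_iff₀ (sub_pos.2 hτ)]
  nlinarith

/-- **GRIFFITHS, lower end**: `∂⁺f(σ) ≤ e_{Ψ₁}(ω)` for every class minimiser `ω ∈ S` of `Ψ₀ + σΨ₁`.
[cite: Griffiths1966, §II] [cite: Israel1979, §II.1 eq. (1)–(2)] -/
theorem rightDeriv_le_meanEnergy_of_isMinOn {ω : InfVolFermionState d} {σ : ℝ} (hω : ω ∈ S)
    (hmin : IsMinOn (fun ω' : InfVolFermionState d => ω'.meanEnergy (pencil Ψ₀ Ψ₁ σ) R) S ω) :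
    derivWithin (fun s => infMeanEnergyOn S (pencil Ψ₀ Ψ₁ s) R) (Ioi σ) σ ≤ ω.meanEnergy Ψ₁ R :=
  le_of_tendsto (tendsto_slope_nhdsGT_infMeanEnergyOn_pencil S Ψ₀ Ψ₁ R σ)
    (eventually_nhdsWithin_of_forall fun _ ht => slope_le_meanEnergy_of_isMinOn hω hmin ht)

/-- **GRIFFITHS, upper end**: `e_{Ψ₁}(ω) ≤ ∂⁻f(σ)` for every class minimiser `ω ∈ S` of `Ψ₀ + σΨ₁`.
[cite: Griffiths1966, §II] [cite: Israel1979, §II.1 eq. (1)–(2)] -/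
theorem meanEnergy_le_leftDeriv_of_isMinOn {ω : InfVolFermionState d} {σ : ℝ} (hω : ω ∈ S)
    (hmin : IsMinOn (fun ω' : InfVolFermionState d => ω'.meanEnergy (pencil Ψ₀ Ψ₁ σ) R) S ω) :
    ω.meanEnergy Ψ₁ R ≤ derivWithin (fun s => infMeanEnergyOn S (pencil Ψ₀ Ψ₁ s) R) (Iio σ) σ :=
  ge_of_tendsto (tendsto_slope_nhdsLT_infMeanEnergyOn_pencil S Ψ₀ Ψ₁ R σ)
    (eventually_nhdsWithin_of_forall fun _ ht => meanEnergy_le_slope_of_isMinOn hω hmin ht)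

/-- **GRIFFITHS' BRACKET**: the conjugate density of every class minimiser lies in `[∂⁺f(σ), ∂⁻f(σ)]`.
[cite: Griffiths1966, §II] [cite: KomaTasaki1994, §1] -/
theorem meanEnergy_mem_Icc_derivs_of_isMinOn {ω : InfVolFermionState d} {σ : ℝ} (hω : ω ∈ S)
    (hmin : IsMinOn (fun ω' : InfVolFermionState d => ω'.meanEnergy (pencil Ψ₀ Ψ₁ σ) R) S ω) :
    ω.meanEnergy Ψ₁ R ∈
      Icc (derivWithin (fun s => infMeanEnergyOn S (pencil Ψ₀ Ψ₁ s) R) (Ioi σ) σ)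
        (derivWithin (fun s => infMeanEnergyOn S (pencil Ψ₀ Ψ₁ s) R) (Iio σ) σ) :=
  ⟨rightDeriv_le_meanEnergy_of_isMinOn hω hmin, meanEnergy_le_leftDeriv_of_isMinOn hω hmin⟩

/-- **Certified bracket for the conjugate density of a class minimiser**: caps/floors of the class energy at
`ρ < σ < τ` give `(lo_τ − hi)/(τ − σ) ≤ e_{Ψ₁}(ω) ≤ (hi − lo_ρ)/(σ − ρ)` (the program-free observable row of a
certified energy table, for ANY linear coupling family and ANY class). [cite: Griffiths1966, §II] -/
theorem meanEnergy_mem_Icc_of_isMinOn_of_bounds {ω : InfVolFermionState d} {σ : ℝ} (hω : ω ∈ S)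
    (hmin : IsMinOn (fun ω' : InfVolFermionState d => ω'.meanEnergy (pencil Ψ₀ Ψ₁ σ) R) S ω)
    {ρ τ hi loρ loτ : ℝ} (hρσ : ρ < σ) (hστ : σ < τ)
    (hhi : infMeanEnergyOn S (pencil Ψ₀ Ψ₁ σ) R ≤ hi) (hloρ : loρ ≤ infMeanEnergyOn S (pencil Ψ₀ Ψ₁ ρ) R)
    (hloτ : loτ ≤ infMeanEnergyOn S (pencil Ψ₀ Ψ₁ τ) R) :
    ω.meanEnergy Ψ₁ R ∈ Icc ((loτ - hi) / (τ - σ)) ((hi - loρ) / (σ - ρ)) :=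
  ⟨(rightDeriv_infMeanEnergyOn_pencil_ge_of_bounds S Ψ₀ Ψ₁ R hστ hhi hloτ).trans
      (rightDeriv_le_meanEnergy_of_isMinOn hω hmin),
    (meanEnergy_le_leftDeriv_of_isMinOn hω hmin).trans
      (leftDeriv_infMeanEnergyOn_pencil_le_of_bounds S Ψ₀ Ψ₁ R hρσ hhi hloρ)⟩

/-- **HELLMANN–FEYNMAN at a differentiability point**: if `s ↦ inf_S e_{Ψ₀+sΨ₁}` has derivative `f'` at `σ`,
every class minimiser at `σ` has conjugate density `e_{Ψ₁}(ω) = f'`. [cite: Griffiths1966, §II] -/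
theorem meanEnergy_eq_of_isMinOn_of_hasDerivAt {ω : InfVolFermionState d} {σ : ℝ} (hω : ω ∈ S)
    (hmin : IsMinOn (fun ω' : InfVolFermionState d => ω'.meanEnergy (pencil Ψ₀ Ψ₁ σ) R) S ω) {f' : ℝ}
    (hf : HasDerivAt (fun s => infMeanEnergyOn S (pencil Ψ₀ Ψ₁ s) R) f' σ) :
    ω.meanEnergy Ψ₁ R = f' := by
  have hP : derivWithin (fun s => infMeanEnergyOn S (pencil Ψ₀ Ψ₁ s) R) (Ioi σ) σ = f' :=
    hf.hasDerivWithinAt.derivWithin (uniqueDiffWithinAt_Ioi σ)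
  have hM : derivWithin (fun s => infMeanEnergyOn S (pencil Ψ₀ Ψ₁ s) R) (Iio σ) σ = f' :=
    hf.hasDerivWithinAt.derivWithin (uniqueDiffWithinAt_Iio σ)
  have h := meanEnergy_mem_Icc_derivs_of_isMinOn hω hmin
  rw [hP, hM] at h
  exact le_antisymm h.2 h.1

end FermionInteraction

end Literature.MathematicalPhysics.QuantumLattice

end
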